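import Summits.QuantumFields.YangMills.Theorems.UnitScaleTiltProp7Chart47T3Sym
import Summits.QuantumFields.YangMills.Theorems.UnitScaleTiltProp7ChartSigmaT3
import HarnessLib

/-!
# Route `UnitScaleTilt`, crux K1 child «MinimiserStabilityRegPr» (stmt-QuantumFields-19200), skeleton v10 stub EX, route (α), cut (S3)(i), node (AVG-SYM) — **DEFINITIONS
# FILE: THE TWISTED SYMMETRIC CHART OF RECORD** (OWNER RULING g26-№1 Σ-TWIST, option (T), 2026-08-28 04:42Z): print's DOUBLE-BAR average of [Balaban1985Averaging]
# (89)–(92) — «U̿₁(c) = (\overline{R_{0,c₋}U₁})⁻¹ · (\overline{U₁U₀})_c (Ū₀)_c⁻¹ · R̄_{0,c} \overline{R_{0,c₊}U₁}» — with the ROUTE's SYMMETRIC (0.4) inner average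
# (`Prop7SymAvgGL.descendToGL`, RULING g25-№3) and print's COMB block frames `\overline{R_{0,·}U₁}^{(k)}` (`B7Eq99Concrete.wrec`, the letter of ★w5 g0's (1.37)^cov,
# `Prop7ChartSigmaT3.gaugeAct_mem_fibre_iff_eq137cov`): **`frameTw`** (the frame of the perturbation read at a comparison site), **`dbarTw`** (the twisted descended
# perturbation `w(c₋)⁻¹·D̄_GL(e^{A}U₀)(c)·w(c₊)·D̄_GL(U₀)(c)⁻¹`), **`logChartTw`** (its logarithm = print's `Q_k(U₀, ηA)` of [Balaban1985RegularSpaces] (1.31)∕(1.37) and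
# [Balaban1985BackgroundPropagators] (3.13), for the symmetric fibre), **`QTw := fderiv ℂ (logChartTw U₀) 0`** (print's `Q(U₀)` = «linear part of the function (3.13)»), the remainder
# **`CmapTw := logChartTw − QTw`** ((44)∕(3.14) `C(U₀, ·)`), and the row **`Chart47T3tw`** = [Balaban1985Variational] Prop. 3 ((47)–(49), range sandwich, (55)) for `CmapTw` —
# `Prop7SymAvgGL.Chart47T3sym`'s text VERBATIM at `CmapTw`; plus r08's scheme by `exact`: `chart47tw_of_inputs`

Cell `ym3-torus` ∕ width seat `ym-ust-20520-w5` (gen 3).  YM₃ on T³ is ladder rung R3, not the Clay problem; nothing here is a claim about the stub, the crux or the gap.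

THE PRINT.  [Balaban1985BackgroundPropagators] p. 392: «A next class of operators we have to consider is determined by averaging operators. They were defined in [5], and because the
definition is quite long and complicated we refer the reader to that paper. Let us remark only that the averaging operation used here is the operation U̿ʲ defined by the formulas (89)–(92) of
that paper. We replace U₀ by U in these definitions, and we have for the function (3.13) the following expansion (1/η_j)Q_j(U, ηA) = Q_j(U)A + C_j(U, A), (3.14) where Q_j(U)A is a linear
part of the function (3.13) and C_j(U, A) is an analytic function of A whose expansion begins with second order terms.»  [Balaban1985Averaging] p. 31 (89): «(\overline{\overline{R(V₀)V₁}})_c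
= (\overline{R_{0,c₋}V₁})⁻¹(\overline{V₁V₀})_c(V̄₀)_c⁻¹R̄_{0,c}\overline{R_{0,c₊}V₁}», (92): «(\overline{R_{0,b₋}U₁^{(k)}})⁻¹Ũ₁^kR̄^k_{0,b}\overline{R_{0,b₊}U₁^{(k)}} = (U̿₁^k)_b»,
(87): «u(y) = (\overline{R_{0,y}U₁}^{(k)})⁻¹ on Ω^{(k)}».  [Balaban1985RegularSpaces] p. 81: «The set Σ_k is not contained in 𝔅_k(𝔅_k, V) because the gauge transformations u do not
satisfy the necessary conditions (1.14). The configurations U′ satisfy the equations Ũ′ʲ = V(Ū₀ʲ)⁻¹ on Λ_j, hence U₁ satisfies (Ũ₁^{u j})_b = u(b₋)(Ũ₁ʲ)_bu⁻¹(b₊) = V_b(Ū₀ʲ)_b⁻¹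
(1.30)», p. 82 (1.37): «Q_j(U₀, ηA) = B on Λ_j».  [Balaban1985Variational] p. 285: «Q_j(ηA) = LʲηQ_jA + C_j(LʲηA) (44) … A = A′ − HD(A′), (47) … C_j(LʲηA′ − LʲηHD(A′)) = D(A′) on
Λ_j. (49)», Prop. 3 p. 289 (quoted in `Prop7Chart47T3Defs`).

WHY THIS FILE (RULING g26-№1, on FINDING w5-3 Σ-TWIST).  The computational core `Prop7SymAvgGL.logChartSym U₀ A c = log[D̄_GL(e^{A}U₀)(c)·D̄_GL(U₀)(c)⁻¹]` is UNTWISTED: its zero set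
at datum `B` is the fibre `𝔅_k(V)` itself and its linear part `QSym` is PINNED-covariant (`QSym(D_{U₀}λ) = D_{Ū₀}(λ↓)`), while every chart-side letter of the EX knit — (1.29)
`RestrictedPrint`, (1.38) `IsLandauPrint`, (20) `AvgCondPrint` ∕ Σ_k, (45) `RD*H = 0`, and the N06 operators of [Balaban1985BackgroundPropagators] Thms 3.12–3.13 — lives in print's
RESTRICTED class, whose averaging operator is the linear part of the DOUBLE-BAR average (p. 392 above).  The objects below are that average and its chart for the symmetric fibre:
`logChartTw U₀ (iX) = log(V·Ū₀⁻¹)` IS ★w5 g0's (1.37)^cov (sibling proof file `…Prop7SymAvgTwEq137`), so (20)'s fibre clause follows by `Prop7Chart5T3OfEq137cov.fibreClause_of_eq137cov`;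
the two bridges to the core — `QTw = QSym − D_{Ū₀} ∘ r` and `H^{tw}X := H^{sym}X + D_{U₀}ȟ(r(H^{sym}X))` — are (3c)∕(3e) of the ruling (separate proof files).

DECLARED READINGS ∕ HONEST SCOPE.  (i) `QTw U₀ := fderiv ℂ (logChartTw U₀) 0` BY DEFINITION (as `QSym`); its identification with `QSym − D_{Ū₀}∘r` (r = the linearised accumulated frames)
and with a twisted contour average is NOT here.  (ii) `A` ranges over ALL of `M₂(ℂ)` bondwise (print's `𝔤ᶜ ⊂ M₂(ℂ)`), the frames are `(M₂)ˣ`-valued (`B7Eq99Concrete.wrec` over the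
complete normed algebra `M₂(ℂ)`), read at the canonical `ℤ³` coordinates `coordT3` of the comparison sites (★w5 g0's `(siteShift y)·val`, `Prop7AxialReprPrint.embIter_eq_transl`).
(iii) `Chart47T3tw` is a hypothesis SHAPE, asserted for nothing; it is PROVED here only from r08's displayed `B11Prop3Model.Inputs (CmapTw U₀) H C₂ C₃ B₀ c₄` (`chart47tw_of_inputs`, by
`exact` as `chart47sym_of_inputs`) — the (44)-tw quadratic-analytic input (including the frames' own expansion) is NOT in the tree (RULING g26-№1 (5): not now).  (iv) No smallness of `U₀`
is needed for the definitions.  Count-neutral toward stmt-QuantumFields-19200 (`--supports`); definitions (review lane) + unfoldings; nothing continuum ∕ OS ∕ mass-gap ∕ Clay.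

References: T. Bałaban, CMP **98** (1985) 17–51 [Balaban1985Averaging] ((78)–(82) p.30, (87)–(92) p.31, (97)–(99) p.32); CMP **99** (1985) 75–102 [Balaban1985RegularSpaces] ((1.28)–(1.31)
pp.81–82, (1.37) p.82); CMP **99** (1985) 389–434 [Balaban1985BackgroundPropagators] (p.392, (3.13)–(3.15) p.393); CMP **102** (1985) 277–309 [Balaban1985Variational] ((44)–(51)
pp.285–286, (55) p.286, Prop. 3 p.289); CMP **109** (1987) 249–301 [Balaban1987RG1] ((0.4) p.253).
-/

noncomputable section

open scoped Matrix.Norms.L2Operator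
open Metric Set

namespace Summit.QuantumFields.YangMills.Theorems.Prop7SymAvgTw

open NormedSpace
open Literature.MathematicalPhysics.QuantumFieldTheory.Balaban1983to89
open T3ContinuumYM3Torus
open T3LevelShift (siteShift)
open T3PrintedRegularOrbits (sites_eq)
open T3SectALandauChart (bgUnits)
open B7Prop1Explicit renaming Site → LSite
open B7Prop1Explicit (expUnit)
open B7Eq99Concrete (wrec)
open B10Eq27TorusAxialLog (pull)
open B11Prop3Model (Dfix Inputs Dfix_spec Dfix_ball Dfix_fix)
open B12Lineariz267 (mapsTo_phi phi_psi_of_norm_lt)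
open MatrixLog (mlog)
open Summit.QuantumFields.YangMills.Theorems.Prop7SPrint (basePt)
open Summit.QuantumFields.YangMills.Theorems.Prop7SymAvgGL (descendToGL)

variable (F : T3Family) (n K : ℕ) (h : n ≤ K)

/-! ## §1 The objects: canonical coordinates, the frame of the perturbation, the twisted descended perturbation, its logarithm -/

/-- **THE CANONICAL `ℤ³` COORDINATES OF A COMPARISON-LATTICE SITE** `y ∈ T^{(n)}_0`: the representatives `(siteShift y)·val ∈ [0, N)³` of the corresponding `k`-centre index, so that
`embIter k (siteShift y) = x₀ + Lᵏ·coordT3 y` (`Prop7AxialReprPrint.embIter_eq_transl`; `x₀ = basePt F n K`) — the letter under which ★w5 g0's (1.37)^cov reads the frames `wrec`.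
[cite: Balaban1987RG1, (0.1) p.251; Balaban1985Averaging, (85)–(87) p.31] -/
def coordT3 (y : Site (F.P n) 0) : LSite (F.P K).d :=
  fun μ => (((siteShift (sites_eq F n K h) y) μ).val : ℤ)

/-- **THE ACCUMULATED BLOCK FRAME `w_A(y) = \overline{R_{0,y}e^{A}}^{(k)}` OF THE PERTURBATION `U₁ = e^{A}` RELATIVE TO `U₀`** ([Balaban1985Averaging] (82)∕(97)∕(99), `k = K − n`), read at the
comparison site `y` through the based pullbacks at `x₀` and the canonical coordinates: `B7Eq99Concrete.wrec L (U₀♯) ((e^{A})♯) k (coordT3 y)` — by (87) the INVERSE of the value at the centre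
`y` of the (1.29)-restricted gauge transformation carrying `e^{A}U₀` to the axial gauge (`Prop7ChartSigmaT3.toUnits_descTransf_eq_wrec_inv`).  `(M₂)ˣ`-valued; `A ∈ M₂(ℂ)` bondwise.
[cite: Balaban1985Averaging, (82) p.30, (87) p.31, (97)–(99) p.32] -/
def frameTw (U₀ : GaugeField (F.P K) 0 (Matrix.specialUnitaryGroup (Fin 2) ℂ)) (A : PBond (F.P K) 0 → Matrix (Fin 2) (Fin 2) ℂ)
    (y : Site (F.P n) 0) : (Matrix (Fin 2) (Fin 2) ℂ)ˣ :=
  wrec (F.P K).L (pull (bgUnits F K U₀) (basePt F n K)) (pull (fun b => expUnit (A b)) (basePt F n K)) (K - n) (coordT3 F n K h y)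

/-- **PRINT'S DOUBLE-BAR AVERAGE (89)–(92) WITH THE SYMMETRIC INNER AVERAGE — the twisted descended perturbation**:
`U̿^{tw}(A)(c) := w_A(c₋)⁻¹ · D̄_GL(e^{A}U₀)(c) · w_A(c₊) · D̄_GL(U₀)(c)⁻¹` (print: `(\overline{R_{0,c₋}U₁})⁻¹(\overline{U₁U₀})_c(Ū₀)_c⁻¹R̄_{0,c}\overline{R_{0,c₊}U₁}` with `R̄_{0,c}X = Ū₀(c)XŪ₀(c)⁻¹`,
i.e. `(Ū₀)_c⁻¹R̄_{0,c}w(c₊) = w(c₊)Ū₀(c)⁻¹`).  Its value is `V(c)·Ū₀(c)⁻¹` EXACTLY WHEN `D̄(e^{A}U₀)(c) = w(c₋)V(c)w(c₊)⁻¹` — ★w5 g0's (1.37)^cov, the fibre clause of Σ_k for the symmetric fibre.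
[cite: Balaban1985Averaging, (89)–(92) p.31; Balaban1985RegularSpaces, (1.30)–(1.31) pp.81–82] -/
def dbarTw (U₀ : GaugeField (F.P K) 0 (Matrix.specialUnitaryGroup (Fin 2) ℂ)) (A : PBond (F.P K) 0 → Matrix (Fin 2) (Fin 2) ℂ)
    (c : PBond (F.P n) 0) : (Matrix (Fin 2) (Fin 2) ℂ)ˣ :=
  (frameTw F n K h U₀ A c.src)⁻¹ * descendToGL F n K h (fun b => expUnit (A b) * bgUnits F K U₀ b) c * frameTw F n K h U₀ A c.tgt
    * (descendToGL F n K h (bgUnits F K U₀) c)⁻¹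

/-- **THE TWISTED LOG-CHART `A ↦ log U̿^{tw}(A)`** — print's `Q_k(U₀, ηA)` of (1.31)∕(1.37) ∕ «the function (3.13)», for the symmetric fibre; complexified (`A ∈ M₂(ℂ)` bondwise).
[cite: Balaban1985RegularSpaces, (1.31) p.82, (1.37) p.82; Balaban1985BackgroundPropagators, (3.13)–(3.14) p.393; Balaban1985Variational, (44) p.285] -/
def logChartTw (U₀ : GaugeField (F.P K) 0 (Matrix.specialUnitaryGroup (Fin 2) ℂ)) (A : PBond (F.P K) 0 → Matrix (Fin 2) (Fin 2) ℂ) :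
    PBond (F.P n) 0 → Matrix (Fin 2) (Fin 2) ℂ :=
  fun c => mlog ((dbarTw F n K h U₀ A c : (Matrix (Fin 2) (Fin 2) ℂ)ˣ) : Matrix (Fin 2) (Fin 2) ℂ)

/-- **PRINT'S AVERAGING OPERATOR `Q(U₀) := QTw U₀`** — «Q_j(U)A is a linear part of the function (3.13)»: the Fréchet derivative of the twisted log-chart at `A = 0`, read as a DEFINITION
(its bridge `QTw = QSym − D_{Ū₀}∘r` to the computational core is a separate theorem). [cite: Balaban1985BackgroundPropagators, (3.14)–(3.15) p.393; Balaban1985Variational, (44) p.285] -/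
def QTw (U₀ : GaugeField (F.P K) 0 (Matrix.specialUnitaryGroup (Fin 2) ℂ)) :
    (PBond (F.P K) 0 → Matrix (Fin 2) (Fin 2) ℂ) →L[ℂ] (PBond (F.P n) 0 → Matrix (Fin 2) (Fin 2) ℂ) :=
  fderiv ℂ (logChartTw F n K h U₀) 0

/-- **THE TWISTED REMAINDER `C(U₀, A) := log U̿^{tw}(A) − Q(U₀)A`** ((3.14) «C_j(U, A) is an analytic function of A whose expansion begins with second order terms»; (44) `C_j`) — the `Ct` of
r08's `B11Prop3Model`. [cite: Balaban1985BackgroundPropagators, (3.14) p.393; Balaban1985Variational, (44) p.285, (49)–(50) p.285] -/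
def CmapTw (U₀ : GaugeField (F.P K) 0 (Matrix.specialUnitaryGroup (Fin 2) ℂ)) (A : PBond (F.P K) 0 → Matrix (Fin 2) (Fin 2) ℂ) :
    PBond (F.P n) 0 → Matrix (Fin 2) (Fin 2) ℂ :=
  logChartTw F n K h U₀ A - QTw F n K h U₀ A

/-! ## §2 The row CHART-47-T³-tw -/

/-- **CHART-47-T³-tw — [Balaban1985Variational] PROPOSITION 3 FOR THE TWISTED SYMMETRIC CHART** (member `F`, `n ≤ K`; background `U₀`; print's `C₂` and radius `ε = ε₃`; the letter `H` an abstract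
linear map from coarse data on the comparison lattice to fine fields — print's (45)–(46) right inverse of `Q(U₀) = QTw U₀`): with `D := B11Prop3Model.Dfix (CmapTw U₀) H C₂` — (49) «C(A′ − HD(A′)) = D(A′)»
on the `ε`-ball; «the range … contains (43) with ε₂ ≦ ½ε»; «… is contained in the corresponding set with 2ε»; (55) «‖D(A′)‖ ≦ 4C₂‖A′‖²».  `Prop7SymAvgGL.Chart47T3sym`'s text VERBATIM at `CmapTw`.
ASSERTED FOR NOTHING; proved from `Inputs` in §4. [cite: Balaban1985Variational, Prop. 3 p.289, (47)–(49) p.285, (55) p.286, (57)–(62) pp.286–287] -/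
def Chart47T3tw (C₂ ε : ℝ) (U₀ : GaugeField (F.P K) 0 (Matrix.specialUnitaryGroup (Fin 2) ℂ))
    (H : (PBond (F.P n) 0 → Matrix (Fin 2) (Fin 2) ℂ) →ₗ[ℂ] (PBond (F.P K) 0 → Matrix (Fin 2) (Fin 2) ℂ)) : Prop :=
  (∀ A' : PBond (F.P K) 0 → Matrix (Fin 2) (Fin 2) ℂ, ‖A'‖ < ε →
      CmapTw F n K h U₀ (A' - H (Dfix (CmapTw F n K h U₀) H C₂ A')) = Dfix (CmapTw F n K h U₀) H C₂ A') ∧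
  (∀ A : PBond (F.P K) 0 → Matrix (Fin 2) (Fin 2) ℂ, ‖A‖ < ε / 2 →
      ∃ A' : PBond (F.P K) 0 → Matrix (Fin 2) (Fin 2) ℂ, ‖A'‖ < ε ∧ A' - H (Dfix (CmapTw F n K h U₀) H C₂ A') = A) ∧
  (∀ A' : PBond (F.P K) 0 → Matrix (Fin 2) (Fin 2) ℂ, ‖A'‖ < ε → ‖A' - H (Dfix (CmapTw F n K h U₀) H C₂ A')‖ < 2 * ε) ∧
  (∀ A' : PBond (F.P K) 0 → Matrix (Fin 2) (Fin 2) ℂ, ‖A'‖ < ε → ‖Dfix (CmapTw F n K h U₀) H C₂ A'‖ ≤ 4 * C₂ * ‖A'‖ ^ 2)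

/-! ## §3 Unfoldings (definitional) -/

variable {F n K h}

/-- `coordT3` IS ★w5 g0's inline letter `fun μ => ((siteShift … y) μ).val` (`rfl`). [cite: Balaban1987RG1, (0.1) p.251] -/
theorem coordT3_apply (y : Site (F.P n) 0) (μ : Fin (F.P K).d) :
    coordT3 F n K h y μ = (((siteShift (sites_eq F n K h) y) μ).val : ℤ) := rfl

/-- `frameTw` unfolded. [cite: Balaban1985Averaging, (82) p.30, (97) p.32] -/
theorem frameTw_def (U₀ : GaugeField (F.P K) 0 (Matrix.specialUnitaryGroup (Fin 2) ℂ)) (A : PBond (F.P K) 0 → Matrix (Fin 2) (Fin 2) ℂ) (y : Site (F.P n) 0) :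
    frameTw F n K h U₀ A y
      = wrec (F.P K).L (pull (bgUnits F K U₀) (basePt F n K)) (pull (fun b => expUnit (A b)) (basePt F n K)) (K - n) (coordT3 F n K h y) := rfl

/-- `dbarTw` unfolded. [cite: Balaban1985Averaging, (89) p.31] -/
theorem dbarTw_def (U₀ : GaugeField (F.P K) 0 (Matrix.specialUnitaryGroup (Fin 2) ℂ)) (A : PBond (F.P K) 0 → Matrix (Fin 2) (Fin 2) ℂ) (c : PBond (F.P n) 0) :
    dbarTw F n K h U₀ A c
      = (frameTw F n K h U₀ A c.src)⁻¹ * descendToGL F n K h (fun b => expUnit (A b) * bgUnits F K U₀ b) c * frameTw F n K h U₀ A c.tgt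
          * (descendToGL F n K h (bgUnits F K U₀) c)⁻¹ := rfl

/-- `logChartTw` bondwise. [cite: Balaban1985RegularSpaces, (1.31) p.82] -/
theorem logChartTw_apply (U₀ : GaugeField (F.P K) 0 (Matrix.specialUnitaryGroup (Fin 2) ℂ)) (A : PBond (F.P K) 0 → Matrix (Fin 2) (Fin 2) ℂ) (c : PBond (F.P n) 0) :
    logChartTw F n K h U₀ A c = mlog ((dbarTw F n K h U₀ A c : (Matrix (Fin 2) (Fin 2) ℂ)ˣ) : Matrix (Fin 2) (Fin 2) ℂ) := rfl

/-- `QTw` unfolded. [cite: Balaban1985BackgroundPropagators, (3.14) p.393] -/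
theorem QTw_def (U₀ : GaugeField (F.P K) 0 (Matrix.specialUnitaryGroup (Fin 2) ℂ)) : QTw F n K h U₀ = fderiv ℂ (logChartTw F n K h U₀) 0 := rfl

/-- `CmapTw` bondwise: `C(U₀, A) = log U̿^{tw}(A) − Q(U₀)A`. [cite: Balaban1985Variational, (44) p.285] -/
theorem CmapTw_apply (U₀ : GaugeField (F.P K) 0 (Matrix.specialUnitaryGroup (Fin 2) ℂ)) (A : PBond (F.P K) 0 → Matrix (Fin 2) (Fin 2) ℂ) :
    CmapTw F n K h U₀ A = logChartTw F n K h U₀ A - QTw F n K h U₀ A := rfl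

/-- `log U̿^{tw}(A) = Q(U₀)A + C(U₀, A)` ((3.14)∕(44), by definition of the remainder). [cite: Balaban1985BackgroundPropagators, (3.14) p.393; Balaban1985Variational, (44) p.285] -/
theorem logChartTw_eq_QTw_add_CmapTw (U₀ : GaugeField (F.P K) 0 (Matrix.specialUnitaryGroup (Fin 2) ℂ)) (A : PBond (F.P K) 0 → Matrix (Fin 2) (Fin 2) ℂ) :
    logChartTw F n K h U₀ A = QTw F n K h U₀ A + CmapTw F n K h U₀ A := by
  rw [CmapTw_apply, add_sub_cancel]

/-! ## §4 CHART-47-T³-tw from the displayed `Inputs` (r08's scheme, verbatim) and (48)-tw -/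

/-- **CHART-47-T³-tw ⇐ (44)-tw∕(72)-tw∕analyticity ∧ (46)-tw ∧ print's smallness**: for the twisted remainder `CmapTw U₀`, any linear `H`, constants with
`B11Prop3Model.Inputs (CmapTw U₀) H C₂ C₃ B₀ c₄` (DISPLAYED — RULING g26-№1 (5): the (44)-tw input is not built now), `C₂, B₀ ≥ 0`, «9C₂B₀ε₃ < 1» and `3ε ≤ 2c₄`:
`Chart47T3tw F n K h C₂ ε U₀ H` (r08's `Dfix_fix`∕`Dfix_spec`, `B12Lineariz267.phi_psi_of_norm_lt`∕`mapsTo_phi` — by `exact`, as `Prop7SymAvgGL.chart47sym_of_inputs`).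
[cite: Balaban1985Variational, Prop. 3 p.289, (49)–(55) pp.285–286, (57)–(62) pp.286–287] -/
theorem chart47tw_of_inputs {C₂ C₃ B₀ c₄ ε : ℝ} {U₀ : GaugeField (F.P K) 0 (Matrix.specialUnitaryGroup (Fin 2) ℂ)}
    {H : (PBond (F.P n) 0 → Matrix (Fin 2) (Fin 2) ℂ) →ₗ[ℂ] (PBond (F.P K) 0 → Matrix (Fin 2) (Fin 2) ℂ)}
    (hin : Inputs (CmapTw F n K h U₀) H C₂ C₃ B₀ c₄) (hC₂ : 0 ≤ C₂) (hB₀ : 0 ≤ B₀) (hq : 9 * C₂ * B₀ * ε < 1) (hRC : 3 * ε ≤ 2 * c₄) :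
    Chart47T3tw F n K h C₂ ε U₀ H := by
  have hQA := hin.quadAnalytic
  have hDfix := Dfix_fix (Ct := CmapTw F n K h U₀) (hop := H) hQA hC₂ hB₀ hin.norm_H hq hRC
  have hDball := Dfix_ball (Ct := CmapTw F n K h U₀) (hop := H) hQA hC₂ hB₀ hin.norm_H hq hRC
  refine ⟨fun A' hA' => hDfix A' hA', fun A hA => ?_, fun A' hA' => ?_, fun A' hA' => ?_⟩
  · obtain ⟨hΨ, hΦΨ⟩ := phi_psi_of_norm_lt (Dt := Dfix (CmapTw F n K h U₀) H C₂) hQA hC₂ hB₀ hin.norm_H hq hRC hDball hDfix hA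
    exact ⟨A + H (CmapTw F n K h U₀ A), hΨ, hΦΨ⟩
  · have hm := mapsTo_phi (Dt := Dfix (CmapTw F n K h U₀) H C₂) hQA hC₂ hB₀ hin.norm_H hq hRC hDball hDfix (mem_ball_zero_iff.2 hA')
    exact mem_ball_zero_iff.1 hm
  · exact (Dfix_spec (Ct := CmapTw F n K h U₀) (hop := H) hQA hC₂ hB₀ hin.norm_H hq hRC hA').1

/-- ★ **(48)-tw — THE TWISTED CHART LINEARISES THE DOUBLE-BAR AVERAGE**: `Chart47T3tw … U₀ H` with `H` a right inverse of `Q(U₀) = QTw U₀` ((45)–(46)) gives, for every chart parameter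
`A′` with `‖A′‖ < ε`, `log U̿^{tw}(A′ − HD(A′)) = Q(U₀)A′` — print's «Q_j(η(A′ − HD(A′))) = LʲηQ_jA′ (48)» for the symmetric fibre (three lines of algebra on (49)).
[cite: Balaban1985Variational, (47)–(49) p.285, Prop. 3 p.289] -/
theorem logChartTw_eq_QTw_of_chart47tw {C₂ ε : ℝ} {U₀ : GaugeField (F.P K) 0 (Matrix.specialUnitaryGroup (Fin 2) ℂ)}
    {H : (PBond (F.P n) 0 → Matrix (Fin 2) (Fin 2) ℂ) →ₗ[ℂ] (PBond (F.P K) 0 → Matrix (Fin 2) (Fin 2) ℂ)}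
    (h47 : Chart47T3tw F n K h C₂ ε U₀ H) (hQH : ∀ X, QTw F n K h U₀ (H X) = X)
    (A' : PBond (F.P K) 0 → Matrix (Fin 2) (Fin 2) ℂ) (hA' : ‖A'‖ < ε) :
    logChartTw F n K h U₀ (A' - H (Dfix (CmapTw F n K h U₀) H C₂ A')) = QTw F n K h U₀ A' := by
  have h49 : logChartTw F n K h U₀ (A' - H (Dfix (CmapTw F n K h U₀) H C₂ A'))
      - QTw F n K h U₀ (A' - H (Dfix (CmapTw F n K h U₀) H C₂ A')) = Dfix (CmapTw F n K h U₀) H C₂ A' := h47.1 A' hA'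
  rw [map_sub, hQH, sub_eq_iff_eq_add] at h49
  rw [h49]
  abel

end Summit.QuantumFields.YangMills.Theorems.Prop7SymAvgTw

end
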